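import Summits.QuantumFields.BalabanUV.T4Continuum.Support.NE7K1LinTwoRunMonotone
import Summits.QuantumFields.BalabanUV.T4Continuum.Support.NE7K1LinSchurFoldBox
import Literature.MathematicalPhysics.QuantumFieldTheory.Balaban1983to89.B4BoxCov237

/-!
# NE7K1LinBoxCovEnergy — row NE7 (node U5), candidate route HOM, path H1L, cell K1-lin(s): NEEDS-ESTIMATE #E1, R-E1 — (o2), PART 1:
# B4 (1.13)–(1.14)'s UNIT-LATTICE OPERATOR `Δ_s^{(j)}(□) = a I − a² Q_n G^Π(s) Q_n^*` BUILT FROM THE TWO-CUTOFF LINE ON A NEUMANN BOX,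
# ITS VARIATIONAL FORM, AND THE COERCIVITY `γ₀ I ≤ Δ_s^{(j)}(□) + a₂L_P^{−2}P` (B4 Prop. 2.3 (1.15), lower half) FOR EVERY `s ∈ [0,1]`

Lineage `b2b-balaban-t4-ne7-p2` (CRUX PROVER NE7 #2), generation 77; file 80.  PRICING-NE7 v39 §285 (e) (N-40-5): «(o2) = the decay
of the UNIT-LATTICE (fluctuation) propagator `C_s := (aI − a²Q_nG(σ_s,a)Q_n^* [+ the aL^{−2}P-type term])^{−1}` built from the line's
averaged resolvent … b04's template is `B4BoxCov237` … the coercivity floor of `Δ_s^{(j)}` off the zero mode is THE ONE NEW LINE».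
THIS FILE is that new line ON THE NEUMANN BOX — the geometry in which B4 Lemma 2.4 (2.37) is PRINTED («arbitrary rectangular
parallelepiped □ … built of large blocks», p. 582) and in which b04's hypothesis-free certificate `B4BoxCov237` lives; every
unit-lattice lemma of b04 (`dirBox`, `extB`, `dirBox_blockAvg_le`, `dirBox_extB_le_norm`, `lblock_poincare`, `coercive_of_blockPoincare`,
`blockAvgP_form`, `fineEnergy_ge`) is used BY NAME; what changes is the fine operator:

* §1 `boxEquiv`, **`boxLine L hn M a s`** = the box line `twoCutoffLine(n, a, s)` (`NE7K1LinSchurLineU1`, `T^Π(s) + aQ_n^*Q_n` on the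
  `L`-block labels of the fine Neumann box `boxDom (nL·M)`) transported to b04's index type `↥(boxDom (n·M))`; `boxLine_form` (forms
  transport), **`boxLine_zero`** (at `s = 0` it IS b04's `boxOpR n a 0 M` — run A = Bałaban's NN box operator, `fineOpR_boxDom`),
  `boxLine_coercive` (`min(2,a)‖v‖² ≤ ⟨v, T′v⟩`, file `NE7K1LinTwoRunMonotone.twoCutoffLine_coercive_sharp`), **`boxOpR_form_le_boxLine`**
  (`⟨g, boxOpR(a,0) g⟩ ≤ ⟨g, boxLine(a,s) g⟩` for `s ≥ 0` — the Löwner monotonicity `twoCutoffLine_form_mono`: THIS is the lever that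
  carries b04's NN floor to the whole line), `boxLine_isUnit_det ∕ _mul_inv ∕ _isSymm ∕ _inv_form_nonneg`.
* §2 **`KeffS L hn M a s = a·1 − (a²∕n^{d+1})·indB·(boxLine)⁻¹·indBᵀ`** — B4 (1.14) for the line; `KeffS_form_eq`, `KeffS_form_le`
  (`≤ a‖ψ‖²`), `gStarS`, `energyS_expand`, **`KeffS_form_eq_energy`** (the variational value, uses only `T′·G = 1`), **`fineEnergyS_ge`**
  (`(n²∕2)·U(g) ≤ ⟨g, T′(s)g⟩ − (a∕N)‖indB g‖²`: b04's `fineEnergy_ge` at `m² = 0` + §1's Löwner lever), **`KeffS_form_ge`**: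
  `min(a∕(8(d+1)), 1∕8)·E_□(ψ) ≤ ⟨ψ, Δ_s^{(j)}ψ⟩` for EVERY `s ∈ [0,1]`, `n ≥ 1`, `L ≥ 1`, box `M` — b04's `Keff_form_ge` re-run verbatim.
* §3 **`covOpS L hn ℓ M′ a a₂ s = KeffS + (a₂∕L_P²)·P`** (B4 (1.13), `L_P = ℓ + 1` the NEXT averaging step's block, `P` = b04's `blockAvgP`,
  unit box of side lengths `L_P·M′`); `covOpS_isSymm`, **`covOpS_form_ge`** (`γ₀ = min(min(a∕(8(d+1)),1∕8)∕(ℓ(ℓ+1)∕2), a₂∕L_P²)`, b04's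
  block Poincaré), `covOpS_isUnit ∕ _mul_inv`, `covOpS_form_le` (`≤ (a + a₂∕L_P²)‖ω‖²`) — (1.15) both halves, constants in
  `(d, ℓ, a, a₂)` only: NO `s`, `n`, `L`, `M′` ((k1); (k2): every `s ∈ [0,1]`, not `s = 1`).
The entry bound and the Combes–Thomas decay (2.37) are file 81 (`NE7K1LinBoxCov237`, with file 77's (2.35) first quantity).

HONEST FRAMING: [folklore]; b04's audit proof of (1.15) for `Ω = □`, `A = 0` re-run with the fine operator generalised from `boxOpR` to the
two-cutoff line and ONE Löwner comparison; nothing of Bałaban's asserted; no `sorry`.  The TORUS variant named in N-40-5 («torus first») differs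
only in the zero-mode bookkeeping and is not typed here (b04 has no torus `dirBox`∕Poincaré layer; the printed (2.37) is the box).  Census only
((o2) part 1); NE7 NOT PRINTED ∕ NOT PROVED; spine 0∕9; FIXED FINITE T⁴, rung (B)+1; NOT infinite volume, NOT mass gap, NOT Clay.  HONEST
DEPENDENCY: continuum YM on T⁴ ⇐ BetaPertH ∧ nine spine estimates (0/9 proved); BetaPertH ⇐ (D1) ∧ (D4) ∧ CAP+tail; G-an2-4 gates asym, D1
and NE2/3/4.
-/

noncomputable section

open Finset Matrix

namespace Summit.QuantumFields.BalabanUV.T4Continuum.NE7K1LinBoxCovEnergy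

open Literature.MathematicalPhysics.QuantumFieldTheory.Balaban1983to89
open Literature.MathematicalPhysics.QuantumFieldTheory.Balaban1983to89.B4Reflection242
open Literature.MathematicalPhysics.QuantumFieldTheory.Balaban1983to89.B4Lower18
open Literature.MathematicalPhysics.QuantumFieldTheory.Balaban1983to89.B4ContourShift (supNorm)
open Literature.MathematicalPhysics.QuantumFieldTheory.Balaban1983to89.B4BoxCov237
open Literature.MathematicalPhysics.QuantumFieldTheory.Balaban1983to89.B4Green242Bridge (boxNbrs zero_mem_boxDom)
open Literature.MathematicalPhysics.QuantumFieldTheory.Balaban1983to89.B4Green244 (finePt)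
open Literature.MathematicalPhysics.QuantumFieldTheory.Balaban1983to89.Beta.BlockPoincare (avg coercive_of_blockPoincare
  card_mul_avg_sq_le)
open NE7K1LinSchurLineU1 NE7K1LinTwoRunMonotone NE7K1LinSchurFoldBox

variable {d : ℕ}

/-! ### §1 The box line on b04's index type -/

section Line

variable {n : ℕ} (L : ℕ) [NeZero L] {M : Fin (d + 1) → ℕ}

/-- the `L`-block labels of the fine Neumann box `boxDom (nL·M)` ARE the points of `boxDom (n·M)` (file 34's `image_fineBox`), as an
equivalence of index types. [folklore] -/
def boxEquiv (n L : ℕ) [NeZero L] (M : Fin (d + 1) → ℕ) :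
    ↥((boxDom fun i => n * L * M i).image (blk L)) ≃ ↥(boxDom fun i => n * M i) :=
  Equiv.subtypeEquivRight (fun x => by rw [image_fineBox (NeZero.one_le : 1 ≤ L) n M])

/-- **THE BOX LINE** `T′ = T^Π(s) + a·Q_n^*Q_n = twoCutoffLine(n, a, s)` of the Neumann box, transported to `↥(boxDom (n·M))`. [folklore] -/
def boxLine (hn : 1 ≤ n) (M : Fin (d + 1) → ℕ) (a s : ℝ) :
    Matrix ↥(boxDom fun i => n * M i) ↥(boxDom fun i => n * M i) ℝ :=
  Matrix.reindex (boxEquiv n L M) (boxEquiv n L M)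
    (twoCutoffLine (isBlockUnion_fine (fineBox_isBlockUnion hn (NeZero.one_le : 1 ≤ L) M)) n a s)

/-- forms transport along the reindexing. [folklore] -/
theorem boxLine_form (hn : 1 ≤ n) (a s : ℝ) (v : ↥(boxDom fun i => n * M i) → ℝ) :
    v ⬝ᵥ (boxLine L hn M a s).mulVec v =
      (v ∘ boxEquiv n L M) ⬝ᵥ (twoCutoffLine (isBlockUnion_fine (fineBox_isBlockUnion hn (NeZero.one_le : 1 ≤ L) M)) n a s).mulVec
        (v ∘ boxEquiv n L M) := by
  simp only [dotProduct, Matrix.mulVec, boxLine, Matrix.reindex_apply, Matrix.submatrix_apply, Function.comp]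
  rw [← Equiv.sum_comp (boxEquiv n L M)]
  refine Finset.sum_congr rfl fun x _ => ?_
  rw [← Equiv.sum_comp (boxEquiv n L M)]
  simp only [Equiv.symm_apply_apply]

/-- the square norm transports. [folklore] -/
theorem normSq_comp_boxEquiv (v : ↥(boxDom fun i => n * M i) → ℝ) :
    (v ∘ boxEquiv n L M) ⬝ᵥ (v ∘ boxEquiv n L M) = v ⬝ᵥ v := by
  simp only [dotProduct, Function.comp]
  exact Equiv.sum_comp (boxEquiv n L M) (fun x => v x * v x)

/-- **AT `s = 0` THE BOX LINE IS BAŁABAN'S NN BOX OPERATOR**: `boxLine(n, a, 0) = boxOpR n a 0 M` (run A = `fineOpR n a 0` on the box,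
`B4Lower18.fineOpR_boxDom`). [folklore] -/
theorem boxLine_zero (hn : 1 ≤ n) (a : ℝ) : boxLine L hn M a 0 = boxOpR n a 0 M := by
  have h0 : twoCutoffLine (isBlockUnion_fine (fineBox_isBlockUnion hn (NeZero.one_le : 1 ≤ L) M)) n a 0 =
      runA n L a (boxDom fun i => n * L * M i) := by
    rw [twoCutoffLine_eq]; simp
  rw [← fineOpR_boxDom]
  ext x y
  simp only [boxLine, Matrix.reindex_apply, Matrix.submatrix_apply, h0, runA, fineOpR, regionOpR, Matrix.of_apply]
  have hx : ((boxEquiv n L M).symm x).1 = x.1 := rfl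
  have hy : ((boxEquiv n L M).symm y).1 = y.1 := rfl
  rw [hx, hy, image_fineBox (NeZero.one_le : 1 ≤ L) n M]

/-- coercivity of the box line: `min(2,a)‖v‖² ≤ ⟨v, T′(s)v⟩` for `a > 0`, `s ≥ 0`. [folklore] -/
theorem boxLine_coercive (hn : 1 ≤ n) {a : ℝ} (ha : 0 < a) {s : ℝ} (hs : 0 ≤ s) (v : ↥(boxDom fun i => n * M i) → ℝ) :
    min 2 a * (v ⬝ᵥ v) ≤ v ⬝ᵥ (boxLine L hn M a s).mulVec v := by
  rw [boxLine_form, ← normSq_comp_boxEquiv L v]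
  exact twoCutoffLine_coercive_sharp hn (fineBox_isBlockUnion hn (NeZero.one_le : 1 ≤ L) M) ha hs _

/-- the form of the box line is nonnegative. [folklore] -/
theorem boxLine_form_nonneg (hn : 1 ≤ n) {a : ℝ} (ha : 0 < a) {s : ℝ} (hs : 0 ≤ s) (v : ↥(boxDom fun i => n * M i) → ℝ) :
    0 ≤ v ⬝ᵥ (boxLine L hn M a s).mulVec v :=
  le_trans (mul_nonneg (lt_min (by norm_num) ha).le (Finset.sum_nonneg fun i _ => mul_self_nonneg (v i)))
    (boxLine_coercive L hn ha hs v)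

/-- **THE LÖWNER LEVER**: `⟨g, boxOpR(n, a, 0) g⟩ ≤ ⟨g, T′(s) g⟩` for every `s ≥ 0` — the two-cutoff line lies above run A (its `s = 0` end),
file `NE7K1LinTwoRunMonotone.twoCutoffLine_form_mono`. [folklore] -/
theorem boxOpR_form_le_boxLine (hn : 1 ≤ n) {a : ℝ} (ha : 0 < a) {s : ℝ} (hs : 0 ≤ s) (g : ↥(boxDom fun i => n * M i) → ℝ) :
    g ⬝ᵥ (boxOpR n a 0 M).mulVec g ≤ g ⬝ᵥ (boxLine L hn M a s).mulVec g := by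
  rw [← boxLine_zero L hn a, boxLine_form, boxLine_form]
  exact twoCutoffLine_form_mono hn (fineBox_isBlockUnion hn (NeZero.one_le : 1 ≤ L) M) ha hs _

/-- the box line has unit determinant for `a > 0`, `0 ≤ s ≤ 1` (file 34). [folklore] -/
theorem boxLine_isUnit_det (hn : 1 ≤ n) (hM : ∀ i, 1 ≤ M i) {a : ℝ} (ha : 0 < a) {s : ℝ} (hs0 : 0 ≤ s) (hs1 : s ≤ 1) :
    IsUnit (boxLine L hn M a s).det := by
  rw [boxLine, Matrix.det_reindex_self]
  exact isUnit_det_twoCutoffLine hn ha M hs0 hs1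
    ((boxEquiv n L M).symm ⟨0, zero_mem_boxDom (NE7K1LinFoldMatrices.mul_pos_side hn hM)⟩)

/-- `T′·T′⁻¹ = 1`. [folklore] -/
theorem boxLine_mul_inv (hn : 1 ≤ n) (hM : ∀ i, 1 ≤ M i) {a : ℝ} (ha : 0 < a) {s : ℝ} (hs0 : 0 ≤ s) (hs1 : s ≤ 1) :
    boxLine L hn M a s * (boxLine L hn M a s)⁻¹ = 1 :=
  Matrix.mul_nonsing_inv _ (boxLine_isUnit_det L hn hM ha hs0 hs1)

/-- the box line is symmetric. [folklore] -/
theorem boxLine_isSymm (hn : 1 ≤ n) (a s : ℝ) : (boxLine L hn M a s).IsSymm := by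
  unfold boxLine
  rw [Matrix.reindex_apply]
  exact (twoCutoffLine_isSymm _ n a s).submatrix _

/-- the Green form of the box line is nonnegative: `0 ≤ ⟨w, T′⁻¹w⟩`. [folklore] -/
theorem boxLine_inv_form_nonneg (hn : 1 ≤ n) (hM : ∀ i, 1 ≤ M i) {a : ℝ} (ha : 0 < a) {s : ℝ} (hs0 : 0 ≤ s) (hs1 : s ≤ 1)
    (w : ↥(boxDom fun i => n * M i) → ℝ) : 0 ≤ w ⬝ᵥ ((boxLine L hn M a s)⁻¹).mulVec w := by
  set u := ((boxLine L hn M a s)⁻¹).mulVec w with hu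
  have hw : (boxLine L hn M a s).mulVec u = w := by
    rw [hu, Matrix.mulVec_mulVec, boxLine_mul_inv L hn hM ha hs0 hs1, Matrix.one_mulVec]
  calc (0 : ℝ) ≤ u ⬝ᵥ (boxLine L hn M a s).mulVec u := boxLine_form_nonneg L hn ha hs0 u
    _ = w ⬝ᵥ u := by rw [hw, dotProduct_comm]

end Line

/-! ### §2 `Δ_s^{(j)}(□) = aI − a²Q_nG^Π(s)Q_n^*` and its variational form -/

section Keff

variable {n : ℕ} (L : ℕ) [NeZero L] {M : Fin (d + 1) → ℕ}

/-- **B4 (1.14) FOR THE LINE**: `Δ_s^{(j)}(□) = a·1 − (a²∕n^{d+1})·indB·(T^Π(s) + aQ_n^*Q_n)⁻¹·indBᵀ` on the unit box `boxDom M` (b04's `Keff`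
with `boxOpR ↦ boxLine`). [folklore] -/
def KeffS (hn : 1 ≤ n) (M : Fin (d + 1) → ℕ) (a s : ℝ) : Matrix ↥(boxDom M) ↥(boxDom M) ℝ :=
  a • (1 : Matrix ↥(boxDom M) ↥(boxDom M) ℝ)
    - (a ^ 2 * ((n : ℝ) ^ (d + 1))⁻¹) • (indB n M * (boxLine L hn M a s)⁻¹ * (indB n M)ᵀ)

/-- `Δ_s^{(j)}(□)` is symmetric. [folklore] -/
theorem KeffS_isSymm (hn : 1 ≤ n) (a s : ℝ) : (KeffS L hn M a s).IsSymm := by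
  have hG : ((boxLine L hn M a s)⁻¹).IsSymm := (boxLine_isSymm L hn a s).inv
  unfold Matrix.IsSymm at hG ⊢
  simp only [KeffS, Matrix.transpose_sub, Matrix.transpose_smul, Matrix.transpose_one, Matrix.transpose_mul,
    Matrix.transpose_transpose, hG, Matrix.mul_assoc]

/-- the form of `Δ_s^{(j)}(□)`: `ψ ⬝ Δψ = a‖ψ‖² − (a²∕n^{d+1})·(indBᵀψ) ⬝ G (indBᵀψ)`. [folklore] -/
theorem KeffS_form_eq (hn : 1 ≤ n) (a s : ℝ) (ψ : ↥(boxDom M) → ℝ) :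
    ψ ⬝ᵥ (KeffS L hn M a s).mulVec ψ
      = a * (ψ ⬝ᵥ ψ) - a ^ 2 * ((n : ℝ) ^ (d + 1))⁻¹ *
          ((indB n M)ᵀ.mulVec ψ ⬝ᵥ ((boxLine L hn M a s)⁻¹).mulVec ((indB n M)ᵀ.mulVec ψ)) := by
  rw [KeffS, Matrix.sub_mulVec, Matrix.smul_mulVec, Matrix.one_mulVec, dotProduct_sub, dotProduct_smul,
    smul_eq_mul, Matrix.smul_mulVec, dotProduct_smul, smul_eq_mul, ← Matrix.mulVec_mulVec, ← Matrix.mulVec_mulVec,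
    Matrix.dotProduct_mulVec ψ (indB n M), ← Matrix.mulVec_transpose]

/-- **UPPER BOUND** `ψ ⬝ Δ_s^{(j)}(□)ψ ≤ a‖ψ‖²`. [folklore] -/
theorem KeffS_form_le (hn : 1 ≤ n) (hM : ∀ i, 1 ≤ M i) {a : ℝ} (ha : 0 < a) {s : ℝ} (hs0 : 0 ≤ s) (hs1 : s ≤ 1)
    (ψ : ↥(boxDom M) → ℝ) : ψ ⬝ᵥ (KeffS L hn M a s).mulVec ψ ≤ a * (ψ ⬝ᵥ ψ) := by
  rw [KeffS_form_eq]
  have h := boxLine_inv_form_nonneg L hn hM ha hs0 hs1 ((indB n M)ᵀ.mulVec ψ)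
  have : 0 ≤ a ^ 2 * ((n : ℝ) ^ (d + 1))⁻¹ *
      ((indB n M)ᵀ.mulVec ψ ⬝ᵥ ((boxLine L hn M a s)⁻¹).mulVec ((indB n M)ᵀ.mulVec ψ)) := mul_nonneg (by positivity) h
  linarith

/-- the minimiser `g⋆ = a·G(indBᵀψ)`. [folklore] -/
def gStarS (hn : 1 ≤ n) (M : Fin (d + 1) → ℕ) (a s : ℝ) (ψ : ↥(boxDom M) → ℝ) : ↥(boxDom fun i => n * M i) → ℝ :=
  a • ((boxLine L hn M a s)⁻¹).mulVec ((indB n M)ᵀ.mulVec ψ)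

/-- completing the square (b04's `energy_expand` with `boxOpR ↦ boxLine`). [folklore] -/
theorem energyS_expand (hn : 1 ≤ n) (a s : ℝ) (ψ : ↥(boxDom M) → ℝ) (g : ↥(boxDom fun i => n * M i) → ℝ) :
    a * (∑ y, (ψ y - ((n : ℝ) ^ (d + 1))⁻¹ * (indB n M).mulVec g y) ^ 2)
      + ((n : ℝ) ^ (d + 1))⁻¹ * (g ⬝ᵥ (boxLine L hn M a s).mulVec g
          - a * ((n : ℝ) ^ (d + 1))⁻¹ * ∑ y, (indB n M).mulVec g y ^ 2)
      = a * (ψ ⬝ᵥ ψ) - 2 * a * ((n : ℝ) ^ (d + 1))⁻¹ * ((indB n M)ᵀ.mulVec ψ ⬝ᵥ g)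
        + ((n : ℝ) ^ (d + 1))⁻¹ * (g ⬝ᵥ (boxLine L hn M a s).mulVec g) := by
  have hcross : (indB n M)ᵀ.mulVec ψ ⬝ᵥ g = ∑ y, ψ y * (indB n M).mulVec g y := by
    rw [Matrix.mulVec_transpose, ← Matrix.dotProduct_mulVec]
    rfl
  have hsq : ∑ y, (ψ y - ((n : ℝ) ^ (d + 1))⁻¹ * (indB n M).mulVec g y) ^ 2
      = (ψ ⬝ᵥ ψ) - 2 * ((n : ℝ) ^ (d + 1))⁻¹ * (∑ y, ψ y * (indB n M).mulVec g y)
        + (((n : ℝ) ^ (d + 1))⁻¹) ^ 2 * ∑ y, (indB n M).mulVec g y ^ 2 := by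
    unfold dotProduct
    rw [Finset.mul_sum, Finset.mul_sum, ← Finset.sum_sub_distrib, ← Finset.sum_add_distrib]
    refine Finset.sum_congr rfl fun y _ => ?_
    ring
  rw [hsq, hcross]
  ring

/-- **THE VARIATIONAL VALUE** `ψ ⬝ Δ_s^{(j)}(□)ψ = a‖ψ − Q g⋆‖² + N⁻¹·(g⋆ ⬝ T′g⋆ − (a∕N)‖indB g⋆‖²)` (uses only `T′·G = 1`). [folklore] -/
theorem KeffS_form_eq_energy (hn : 1 ≤ n) (hM : ∀ i, 1 ≤ M i) {a : ℝ} (ha : 0 < a) {s : ℝ} (hs0 : 0 ≤ s) (hs1 : s ≤ 1)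
    (ψ : ↥(boxDom M) → ℝ) :
    ψ ⬝ᵥ (KeffS L hn M a s).mulVec ψ
      = a * (∑ y, (ψ y - ((n : ℝ) ^ (d + 1))⁻¹ * (indB n M).mulVec (gStarS L hn M a s ψ) y) ^ 2)
        + ((n : ℝ) ^ (d + 1))⁻¹ * (gStarS L hn M a s ψ ⬝ᵥ (boxLine L hn M a s).mulVec (gStarS L hn M a s ψ)
            - a * ((n : ℝ) ^ (d + 1))⁻¹ * ∑ y, (indB n M).mulVec (gStarS L hn M a s ψ) y ^ 2) := by
  rw [energyS_expand, KeffS_form_eq]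
  set T := boxLine L hn M a s
  set G := (boxLine L hn M a s)⁻¹
  set φ := (indB n M)ᵀ.mulVec ψ
  have hT : ∀ v, T.mulVec (G.mulVec v) = v := fun v => by
    rw [Matrix.mulVec_mulVec, boxLine_mul_inv L hn hM ha hs0 hs1, Matrix.one_mulVec]
  have hg : gStarS L hn M a s ψ = a • G.mulVec φ := rfl
  rw [hg]
  have h1 : a • G.mulVec φ ⬝ᵥ T.mulVec (a • G.mulVec φ) = a * (a * (φ ⬝ᵥ G.mulVec φ)) := by
    rw [Matrix.mulVec_smul, hT, smul_dotProduct, dotProduct_smul, smul_eq_mul, smul_eq_mul, dotProduct_comm]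
  have h2 : φ ⬝ᵥ a • G.mulVec φ = a * (φ ⬝ᵥ G.mulVec φ) := by
    rw [dotProduct_smul, smul_eq_mul]
  rw [h1, h2]
  ring

/-- **THE FINE KINETIC FORM ALONG THE LINE**: `(n²∕2)·ΣΣ(g x − g x′)² ≤ g ⬝ T′(s)g − (a∕N)·Σ_y (indB g)_y²` for every `s ≥ 0` — b04's
`fineEnergy_ge` at `m² = 0` (run A) lifted along the line by the Löwner lever. [folklore] -/
theorem fineEnergyS_ge (hn : 1 ≤ n) {a : ℝ} (ha : 0 < a) {s : ℝ} (hs : 0 ≤ s) (g : ↥(boxDom fun i => n * M i) → ℝ) :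
    (n : ℝ) ^ 2 / 2 * (∑ x, ∑ x' ∈ boxNbrs (fun i => n * M i) x, (g x - g x') ^ 2)
      ≤ g ⬝ᵥ (boxLine L hn M a s).mulVec g - a * ((n : ℝ) ^ (d + 1))⁻¹ * ∑ y, (indB n M).mulVec g y ^ 2 := by
  have h0 := fineEnergy_ge hn a (le_refl (0 : ℝ)) M g
  have h1 := boxOpR_form_le_boxLine L hn ha hs g
  linarith
set_option maxHeartbeats 400000 in
/-- **COERCIVITY OF `Δ_s^{(j)}(□)` BY THE UNIT BOND FORM, EVERY `s ∈ [0,1]`**: `min(a∕(8(d+1)), 1∕8)·E_□(ψ) ≤ ψ ⬝ Δ_s^{(j)}(□)ψ`, uniformly in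
`s`, `n`, `L` and the box (b04's `Keff_form_ge` re-run). [folklore] -/
theorem KeffS_form_ge (hn : 1 ≤ n) {a : ℝ} (ha : 0 < a) {s : ℝ} (hs0 : 0 ≤ s) (hs1 : s ≤ 1) (hM : ∀ i, 1 ≤ M i)
    (ψ : ↥(boxDom M) → ℝ) :
    min (a / (8 * (d + 1))) (1 / 8) * dirBox M (extB M ψ) ≤ ψ ⬝ᵥ (KeffS L hn M a s).mulVec ψ := by
  have hn0 : (0 : ℝ) < n := by exact_mod_cast hn
  set N : ℝ := (n : ℝ) ^ (d + 1) with hNdef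
  have hN0 : 0 < N := by positivity
  set g := gStarS L hn M a s ψ with hg
  set w := (indB n M).mulVec g with hw
  set Q : ↥(boxDom M) → ℝ := N⁻¹ • w with hQ
  set A : ℝ := ∑ y, (ψ y - N⁻¹ * w y) ^ 2 with hA
  set B : ℝ := g ⬝ᵥ (boxLine L hn M a s).mulVec g - a * N⁻¹ * ∑ y, w y ^ 2 with hB
  set U : ℝ := ∑ x, ∑ x' ∈ boxNbrs (fun i => n * M i) x, (g x - g x') ^ 2 with hU
  have hF : ψ ⬝ᵥ (KeffS L hn M a s).mulVec ψ = a * A + N⁻¹ * B := KeffS_form_eq_energy L hn hM ha hs0 hs1 ψ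
  have hA0 : 0 ≤ A := Finset.sum_nonneg fun _ _ => sq_nonneg _
  have hU0 : 0 ≤ U := Finset.sum_nonneg fun _ _ => Finset.sum_nonneg fun _ _ => sq_nonneg _
  have hBU : (n : ℝ) ^ 2 / 2 * U ≤ B := fineEnergyS_ge L hn ha hs0 g
  have hB0 : 0 ≤ B := le_trans (mul_nonneg (by positivity) hU0) hBU
  have hsplit : extB M ψ = extB M (ψ - Q) + extB M Q := by
    rw [← extB_add, sub_add_cancel]
  have hE1 : dirBox M (extB M (ψ - Q)) ≤ 4 * (d + 1) * A := by
    have h := dirBox_extB_le_norm (ψ - Q)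
    have hAA : (ψ - Q) ⬝ᵥ (ψ - Q) = A := by
      rw [hA]
      unfold dotProduct
      refine Finset.sum_congr rfl fun y _ => ?_
      simp only [hQ, Pi.sub_apply, Pi.smul_apply, smul_eq_mul]
      ring
    rw [hAA] at h
    exact h
  have hE2 : dirBox M (extB M Q) ≤ 4 * N⁻¹ * B := by
    have h := dirBox_blockAvg_le hn M g
    calc dirBox M (extB M Q) ≤ 2 * (n : ℝ) ^ 2 * N⁻¹ * U := h
      _ = 4 * N⁻¹ * ((n : ℝ) ^ 2 / 2 * U) := by ring
      _ ≤ 4 * N⁻¹ * B := mul_le_mul_of_nonneg_left hBU (by positivity)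
  have hE : dirBox M (extB M ψ) ≤ 8 * (d + 1) * A + 8 * N⁻¹ * B := by
    rw [hsplit]
    have := dirBox_add_le M (extB M (ψ - Q)) (extB M Q)
    linarith
  set c : ℝ := min (a / (8 * (d + 1))) (1 / 8) with hc
  have hc0 : 0 ≤ c := le_min (by positivity) (by norm_num)
  have hc1 : c * (8 * (d + 1)) ≤ a := by
    have : c ≤ a / (8 * (d + 1)) := min_le_left _ _
    have hd : (0 : ℝ) < 8 * (d + 1) := by positivity
    calc c * (8 * (d + 1)) ≤ a / (8 * (d + 1)) * (8 * (d + 1)) := mul_le_mul_of_nonneg_right this hd.le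
      _ = a := div_mul_cancel₀ a hd.ne'
  have hc2 : c * 8 ≤ 1 := by
    have : c ≤ 1 / 8 := min_le_right _ _
    linarith
  rw [hF]
  calc c * dirBox M (extB M ψ) ≤ c * (8 * (d + 1) * A + 8 * N⁻¹ * B) := mul_le_mul_of_nonneg_left hE hc0
    _ = c * (8 * (d + 1)) * A + c * 8 * (N⁻¹ * B) := by ring
    _ ≤ a * A + 1 * (N⁻¹ * B) := by gcongr
    _ = a * A + N⁻¹ * B := by ring

end Keff

/-! ### §3 `C_s^{(j)}(□)^{-1} = Δ_s^{(j)}(□) + a₂L_P^{−2}P` and its coercivity (B4 Prop. 2.3 (1.15), box, every `s`) -/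

section Cov

variable {n : ℕ} (L : ℕ) [NeZero L]

/-- **B4 (1.13) FOR THE LINE**: `C_s^{(j)}(□)^{-1} = Δ_s^{(j)}(□) + a₂L_P^{−2}P` on the unit box of side lengths `L_P·M′`, `L_P = ℓ + 1` the next
averaging step's block, `P` = b04's `blockAvgP` (projection onto `L_P`-block constants). [folklore] -/
def covOpS (hn : 1 ≤ n) (ℓ : ℕ) (M' : Fin (d + 1) → ℕ) (a a₂ s : ℝ) :
    Matrix ↥(boxDom fun i => (ℓ + 1) * M' i) ↥(boxDom fun i => (ℓ + 1) * M' i) ℝ :=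
  KeffS L hn (fun i => (ℓ + 1) * M' i) a s + (a₂ / ((ℓ : ℝ) + 1) ^ 2) • blockAvgP ℓ M'

/-- `C_s^{(j)}(□)^{-1}` is symmetric. [folklore] -/
theorem covOpS_isSymm (hn : 1 ≤ n) (ℓ : ℕ) (M' : Fin (d + 1) → ℕ) (a a₂ s : ℝ) : (covOpS L hn ℓ M' a a₂ s).IsSymm := by
  unfold covOpS
  exact (KeffS_isSymm L hn a s).add ((blockAvgP_isSymm ℓ M').smul _)

/-- **COERCIVITY** (the lower half of (1.15) for the line, `Λ = □^{(j)}`): `γ₀‖ω‖² ≤ ⟨ω, (Δ_s^{(j)}(□) + a₂L_P^{−2}P)ω⟩`,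
`γ₀ = min(min(a∕(8(d+1)), 1∕8)∕(ℓ(ℓ+1)∕2), a₂∕L_P²)`, for EVERY `s ∈ [0,1]`, `n ≥ 1`, `L ≥ 1` and box `M′` (b04's block Poincaré). [folklore] -/
theorem covOpS_form_ge (hn : 1 ≤ n) {ℓ : ℕ} (hℓ : 1 ≤ ℓ) {a a₂ : ℝ} (ha : 0 < a) (ha2 : 0 ≤ a₂) {s : ℝ} (hs0 : 0 ≤ s) (hs1 : s ≤ 1)
    {M' : Fin (d + 1) → ℕ} (hM : ∀ i, 1 ≤ M' i) (ω : ↥(boxDom fun i => (ℓ + 1) * M' i) → ℝ) :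
    min (min (a / (8 * (d + 1))) (1 / 8) / ((ℓ : ℝ) * (ℓ + 1) / 2)) (a₂ / ((ℓ : ℝ) + 1) ^ 2) * (ω ⬝ᵥ ω)
      ≤ ω ⬝ᵥ (covOpS L hn ℓ M' a a₂ s).mulVec ω := by
  have hℓ1 : (1 : ℝ) ≤ ℓ := by exact_mod_cast hℓ
  have hP : (0 : ℝ) < (ℓ : ℝ) * (ℓ + 1) / 2 := by positivity
  have hMℓ : ∀ i, 1 ≤ (ℓ + 1) * M' i := fun i => by nlinarith [hM i]
  refine coercive_of_blockPoincare (lblk ℓ M') bsrc btgt _ hP (lblock_poincare hℓ M')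
    (covOpS L hn ℓ M' a a₂ s) _ _ (le_min (by positivity) (by norm_num)) (by positivity) ?_ ω
  intro ω
  rw [sum_UBond_eq_dirBox, ← blockAvgP_form]
  have hK := KeffS_form_ge L hn ha hs0 hs1 (M := fun i => (ℓ + 1) * M' i) hMℓ ω
  unfold covOpS
  rw [Matrix.add_mulVec, dotProduct_add, Matrix.smul_mulVec, dotProduct_smul, smul_eq_mul]
  linarith

/-- `Δ_s^{(j)}(□) + a₂L_P^{−2}P` is invertible (coercivity), so `(covOpS …)⁻¹` is the genuine inverse `C_s^{(j)}(□)`. [folklore] -/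
theorem covOpS_isUnit (hn : 1 ≤ n) {ℓ : ℕ} (hℓ : 1 ≤ ℓ) {a a₂ : ℝ} (ha : 0 < a) (ha2 : 0 < a₂) {s : ℝ} (hs0 : 0 ≤ s)
    (hs1 : s ≤ 1) {M' : Fin (d + 1) → ℕ} (hM : ∀ i, 1 ≤ M' i) : IsUnit (covOpS L hn ℓ M' a a₂ s) := by
  have hℓ1 : (1 : ℝ) ≤ ℓ := by exact_mod_cast hℓ
  refine QGQInverse.isUnit_of_coercive
    (γ := min (min (a / (8 * (d + 1))) (1 / 8) / ((ℓ : ℝ) * (ℓ + 1) / 2)) (a₂ / ((ℓ : ℝ) + 1) ^ 2))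
    (lt_min (by positivity) (by positivity)) ?_
  intro ω
  exact covOpS_form_ge L hn hℓ ha ha2.le hs0 hs1 hM ω

/-- `covOpS · covOpS⁻¹ = 1`. [folklore] -/
theorem covOpS_mul_inv (hn : 1 ≤ n) {ℓ : ℕ} (hℓ : 1 ≤ ℓ) {a a₂ : ℝ} (ha : 0 < a) (ha2 : 0 < a₂) {s : ℝ} (hs0 : 0 ≤ s)
    (hs1 : s ≤ 1) {M' : Fin (d + 1) → ℕ} (hM : ∀ i, 1 ≤ M' i) :
    covOpS L hn ℓ M' a a₂ s * (covOpS L hn ℓ M' a a₂ s)⁻¹ = 1 :=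
  Matrix.mul_nonsing_inv _ ((Matrix.isUnit_iff_isUnit_det _).1 (covOpS_isUnit L hn hℓ ha ha2 hs0 hs1 hM))

/-- **BOUNDEDNESS** (the upper half of (1.15)): `⟨ω, (Δ_s^{(j)}(□) + a₂L_P^{−2}P)ω⟩ ≤ (a + a₂∕L_P²)‖ω‖²`. [folklore] -/
theorem covOpS_form_le (hn : 1 ≤ n) {ℓ : ℕ} {a a₂ : ℝ} (ha : 0 < a) (ha2 : 0 ≤ a₂) {s : ℝ} (hs0 : 0 ≤ s) (hs1 : s ≤ 1)
    {M' : Fin (d + 1) → ℕ} (hM : ∀ i, 1 ≤ M' i) (ω : ↥(boxDom fun i => (ℓ + 1) * M' i) → ℝ) :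
    ω ⬝ᵥ (covOpS L hn ℓ M' a a₂ s).mulVec ω ≤ (a + a₂ / ((ℓ : ℝ) + 1) ^ 2) * (ω ⬝ᵥ ω) := by
  have hMℓ : ∀ i, 1 ≤ (ℓ + 1) * M' i := fun i => by nlinarith [hM i]
  have hK := KeffS_form_le L hn hMℓ ha hs0 hs1 (M := fun i => (ℓ + 1) * M' i) ω
  have hPle : ω ⬝ᵥ (blockAvgP ℓ M').mulVec ω ≤ ω ⬝ᵥ ω := by
    rw [blockAvgP_form]
    have hn2 : ω ⬝ᵥ ω = ∑ y, ω y ^ 2 := by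
      unfold dotProduct
      exact Finset.sum_congr rfl fun y _ => by ring
    rw [hn2, ← Finset.sum_fiberwise_of_maps_to (s := Finset.univ) (t := Finset.univ) (g := lblk ℓ M')
      (fun y _ => Finset.mem_univ _) (f := fun y => ω y ^ 2)]
    exact Finset.sum_le_sum fun b _ => card_mul_avg_sq_le _ ω
  unfold covOpS
  rw [Matrix.add_mulVec, dotProduct_add, Matrix.smul_mulVec, dotProduct_smul, smul_eq_mul, add_mul]
  have : a₂ / ((ℓ : ℝ) + 1) ^ 2 * (ω ⬝ᵥ (blockAvgP ℓ M').mulVec ω) ≤ a₂ / ((ℓ : ℝ) + 1) ^ 2 * (ω ⬝ᵥ ω) :=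
    mul_le_mul_of_nonneg_left hPle (by positivity)
  linarith

end Cov

end Summit.QuantumFields.BalabanUV.T4Continuum.NE7K1LinBoxCovEnergy

end
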